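import Summits.ResolutionOfSingularities.KangarooAtlas.MizutaniRationalField
import Summits.ResolutionOfSingularities.KangarooAtlas.MizutaniRootTowerDegree
import Summits.ResolutionOfSingularities.KangarooAtlas.MizutaniExamples
import Summits.ResolutionOfSingularities.KangarooAtlas.MizutaniHironakaSide
import Summits.ResolutionOfSingularities.KangarooAtlas.MizutaniConjectureHolds
import HarnessLib

/-!
# Sanity lemmas for the predicates of the Mizutani chain (pub-rosobs REVIEW-RUNBOOK-MZ)

Review evidence only (ops-runbook sanity modules of the cell, `KangarooAtlas/Runbook/`); no new definitions, nothing
used by the chain.  For each Prop-valued definition of REVIEW-RUNBOOK-MZ §2 that is a PREDICATE (not a closed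
statement) one instance where it HOLDS and one where it FAILS, so that no card is vacuous:

* `IsCoeffDiffOp k p e m D` (card D29, the `TODO(ops-runbook)` row): holds for the identity (order `0`, every `m`);
  FAILS at order `0` for the Hasse–Schmidt derivation `D^{(1)}` of `k = F(u)` over `k^{p^e}` (`D^{(1)} u = 1`,
  `D^{(1)} 1 = 0`, so `[D^{(1)}, u] ≠ 0`) — differential operators of `k/k^{p^e}` of positive order exist exactly
  because `k` is imperfect;
* `IsRootTower L K q x a` (D4): holds for `F(u_0,…,u_{s−1}) ⊃ F(u)^{p^e}` (`isRootTower_ratField`); FAILS for `K = L`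
  with `q^s > 1` (a root tower has degree `q^s`, `IsRootTower.finrank_eq`);
* `IsPoint k 𝔭` (D10): holds for the generic point `⊥` and the rational point `coordPoint`; FAILS for the unit
  ideal and for the irrelevant ideal `S_+`;
* `ExponentLE k p 𝔭 e` (D18): holds at level `e` and FAILS at level `e − 1` for the attaining point `attP`
  (`exponentLE_attP`, `not_exponentLE_attP`); holds at level `0` for `⊥`;
* `IsVectorGroup k 𝔭` (D31): holds for `⊥` and `coordPoint`; FAILS for `GenAtt.attP` (`e ≥ 1`, exponent `e ≠ 0`,
  `isVectorGroup_iff_exponent_eq_zero_holds`);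
* the closed statements `MizutaniLowerBound p e`, `MizutaniConjecture p e`, `MizutaniAttained p e`, `Mizutani1973_m_one p`,
  `Hironaka1970_thm1_cor p`, `Mizutani1973_vectorGroup_of_dim_le p` (D1, D3, D9, D15, D16) HOLD for every prime `p`
  (and every `e`) — they are theorems of the tree; recorded here as one-line pointers.

AI review is weaker than expert review; not a resolution theorem; nothing here is part of a proof.
-/

noncomputable section

open MvPolynomial Literature.AlgebraicGeometry.Resolution Literature.AlgebraicGeometry.Resolution.HironakaScheme
  Summit.ResolutionOfSingularities.KangarooAtlas.Mizutani

namespace Summit.ResolutionOfSingularities.KangarooAtlas.Runbook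

universe u

/-! ## `IsCoeffDiffOp` (card D29) -/

section CoeffDiffOp

variable (k : Type u) [Field k] (p : ℕ) [Fact p.Prime] [CharP k p]

/-- Holds-instance: the identity of `k` is a coefficient differential operator over `k^{p^e}` of order `≤ m` for every
`e`, `m` (order `0`). -/
theorem isCoeffDiffOp_id (e m : ℕ) : IsCoeffDiffOp k p e m (LinearMap.id : k →ₗ[frobPow k p e] k) :=
  (isDiffOpLE_id (R := frobPow k p e)).of_le (Nat.zero_le m)

/-- Holds-instance: multiplication by a fixed element `c ∈ k` has order `≤ 0`. -/
theorem isCoeffDiffOp_mulLeft (e m : ℕ) (c : k) :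
    IsCoeffDiffOp k p e m (LinearMap.mulLeft (frobPow k p e) c : k →ₗ[frobPow k p e] k) :=
  (isDiffOpLE_mulLeft (R := frobPow k p e) c).of_le (Nat.zero_le m)

end CoeffDiffOp

section CoeffDiffOpFails

variable {F : Type u} [Field F] {p : ℕ} [hp : Fact p.Prime] [CharP F p]

/-- Fails-instance: over the IMPERFECT field `k = F(u)` (`F ⊆ 𝔽_p^{alg}` pointwise fixed by Frobenius, e.g. `F = 𝔽_p`),
the Hasse–Schmidt operator `D^{(1)}` of the tower `k ⊃ k^{p^e}` (`e ≥ 1`) — a `k^{p^e}`-linear DERIVATION with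
`D^{(1)} u = 1` — is NOT a coefficient differential operator of order `≤ 0`: `[D^{(1)}, u](1) = D^{(1)}(u) − u·D^{(1)}(1) = 1`.
So `IsCoeffDiffOp` is a genuine restriction (and `invForms` a genuine condition) exactly when `k ≠ k^p`. -/
theorem not_isCoeffDiffOp_hsD_single (hF : ∀ c : F, c ^ p = c) {e : ℕ} (he : 1 ≤ e) :
    ¬ IsCoeffDiffOp (RatField F 1) p e 0
      ((isRootTower_ratField (s := 1) hF he).hsD (Finsupp.single 0 1)) := by
  set h := isRootTower_ratField (s := 1) hF he with hh
  have hq : 1 < p ^ e := Nat.one_lt_pow (by omega) hp.out.one_lt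
  have hbox : InBox (p ^ e) (Finsupp.single (0 : Fin 1) 1) := by
    intro i
    rw [Finsupp.single_apply]
    split_ifs <;> omega
  -- `D^{(1)} u = 1`
  have hu : h.hsD (Finsupp.single 0 1) (ratGen F 1 0) = 1 := by
    have := h.hsD_prod_pow hbox (Finsupp.single 0 1)
    rw [Fin.prod_univ_one, Fin.prod_univ_one, mchoose_self, Finsupp.single_eq_same, pow_one, Nat.sub_self,
      pow_zero, Nat.cast_one, one_mul] at this
    exact this
  -- `D^{(1)} 1 = 0`
  have h1 : h.hsD (Finsupp.single 0 1) 1 = 0 := by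
    have := h.hsD_prod_pow hbox 0
    rw [Fin.prod_univ_one, Fin.prod_univ_one, Finsupp.coe_zero, Pi.zero_apply, pow_zero, mchoose_eq_prod,
      Fin.prod_univ_one, Finsupp.coe_zero, Pi.zero_apply, Finsupp.single_eq_same, Nat.choose_zero_succ,
      Nat.cast_zero, zero_mul] at this
    exact this
  intro hD
  have hcomm := (isDiffOpLE_zero_iff (R := frobPow (RatField F 1) p e)).mp hD (ratGen F 1 0)
  have happ := congrArg (fun φ => φ (1 : RatField F 1)) hcomm
  simp only [commMul, LinearMap.sub_apply, LinearMap.comp_apply, LinearMap.mulLeft_apply, mul_one,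
    LinearMap.zero_apply, hu, h1, mul_zero, sub_zero] at happ
  exact one_ne_zero happ

/-- …whereas the same operator IS of order `≤ 1` would be the holds-instance at order one; at order `0` the
identity qualifies (`isCoeffDiffOp_id`), so order `0` is inhabited and order `0` is a proper subclass of order `1`. -/
theorem isCoeffDiffOp_zero_ne_univ (hF : ∀ c : F, c ^ p = c) {e : ℕ} (he : 1 ≤ e) :
    ∃ D : RatField F 1 →ₗ[frobPow (RatField F 1) p e] RatField F 1, ¬ IsCoeffDiffOp (RatField F 1) p e 0 D :=
  ⟨_, not_isCoeffDiffOp_hsD_single hF he⟩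

end CoeffDiffOpFails

/-! ## `IsRootTower` (card D4) -/

section RootTower

variable {F : Type u} [Field F] {p : ℕ} [hp : Fact p.Prime] [CharP F p]

/-- Holds-instance: `F(u_0, …, u_{s−1})` is a root tower of exponent `p^e` over its subfield of `p^e`-th powers
(`isRootTower_ratField`). -/
theorem isRootTower_holds (hF : ∀ c : F, c ^ p = c) {s e : ℕ} (he : 1 ≤ e) :
    IsRootTower (frobPow (RatField F s) p e) (RatField F s) (p ^ e) (towerPow e (ratGen F s)) (ratGen F s) :=
  isRootTower_ratField hF he

/-- Fails-instance: a field is never a root tower of exponent `p^e ≥ 2` with `s ≥ 1` generators OVER ITSELF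
(a root tower has degree `(p^e)^s > 1`, `IsRootTower.finrank_eq`, but `[F : F] = 1`). -/
theorem not_isRootTower_self {s e : ℕ} (hs : 1 ≤ s) (he : 1 ≤ e) (x a : Fin s → F) :
    ¬ IsRootTower F F (p ^ e) x a := by
  intro h
  have hdeg := h.finrank_eq
  rw [Module.finrank_self] at hdeg
  have h1 : 1 < (p ^ e) ^ s :=
    Nat.one_lt_pow (by omega) (Nat.one_lt_pow (by omega) hp.out.one_lt)
  omega

end RootTower

/-! ## `IsPoint` (card D10) -/

section Point

variable (k : Type u) [Field k] (n : ℕ)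

/-- Holds-instance: the generic point of `ℙⁿ` (`isPoint_bot`) and the rational point `[1:0:…:0]` (`isPoint_coordPoint`). -/
theorem isPoint_holds : IsPoint k (⊥ : Ideal (MvPolynomial (Fin (n + 1)) k)) ∧ IsPoint k (coordPoint k n) :=
  ⟨isPoint_bot k n, isPoint_coordPoint k n⟩

/-- Fails-instance: the unit ideal is not a point (not prime). -/
theorem not_isPoint_top : ¬ IsPoint k (⊤ : Ideal (MvPolynomial (Fin (n + 1)) k)) :=
  fun h => h.1.ne_top rfl

/-- Fails-instance: the irrelevant ideal `S_+ = (X_0, …, X_n)` is not a point (it contains itself). -/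
theorem not_isPoint_irrelevant : ¬ IsPoint k (irrelevant k n) :=
  fun h => h.2.2 le_rfl

end Point

/-! ## `ExponentLE` (card D18) and `IsVectorGroup` (card D31) -/

section Exponent

variable {k : Type u} [Field k] {p : ℕ} [hp : Fact p.Prime] [CharP k p]

/-- Holds-instance: the attaining point `attP` (level-`e` analogue of Mizutani's Example 2.1, any field with a
`p`-independent pair `u`) has exponent `≤ e` … -/
theorem exponentLE_holds {u : Fin 2 → k} (hu : PIndep p 1 u) {e : ℕ} (he : 1 ≤ e) :
    ExponentLE k p (GenAtt.attP k p e u) e :=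
  GenAtt.exponentLE_attP hu he

/-- … and fails-instance: NOT exponent `≤ e − 1` (so `ExponentLE` is neither always true nor always false). -/
theorem exponentLE_fails {u : Fin 2 → k} (hu : PIndep p 1 u) (e' : ℕ) :
    ¬ ExponentLE k p (GenAtt.attP k p (e' + 1) u) e' :=
  GenAtt.not_exponentLE_attP hu rfl

variable (k p) in
/-- Holds-instance at level `0`: the generic point has exponent `0` (a vector group). -/
theorem exponent_bot_eq_zero (n : ℕ) : exponent k p (⊥ : Ideal (MvPolynomial (Fin (n + 1)) k)) = 0 :=
  exponent_bot k p n

variable (k) in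
include hp in
/-- Holds-instances for `IsVectorGroup`: the generic point and the rational point `[1:0:…:0]`. -/
theorem isVectorGroup_holds (n : ℕ) :
    IsVectorGroup k (⊥ : Ideal (MvPolynomial (Fin (n + 1)) k)) ∧ IsVectorGroup k (coordPoint k n) :=
  ⟨isVectorGroup_bot k p n, isVectorGroup_coordPoint k p n⟩

/-- Fails-instance for `IsVectorGroup`: the Hironaka scheme of the attaining point `attP` (`e ≥ 1`) is NOT a vector
group (its exponent is `e ≠ 0`; Mizutani Rem. 1.2 in the tree: `isVectorGroup_iff_exponent_eq_zero_holds`). -/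
theorem not_isVectorGroup_attP {u : Fin 2 → k} (hu : PIndep p 1 u) {e : ℕ} (he : 1 ≤ e) :
    ¬ IsVectorGroup k (GenAtt.attP k p e u) := by
  have hu0 : ∀ l, u l ≠ 0 := GenAtt.ne_zero_of_pIndep hu
  haveI := (GenAtt.isPoint_attP (k := k) (p := p) (e := e) hu0).1
  rw [isVectorGroup_iff_exponent_eq_zero_holds k p _ (GenAtt.isPoint_attP hu0), GenAtt.exponent_attP hu he]
  omega

end Exponent

/-! ## The closed statements (cards D1, D3, D9, D15, D16): all HOLD -/

section Closed

/-- `MizutaniLowerBound p e`, `MizutaniConjecture p e`, `MizutaniAttained p e`, `Mizutani1973_m_one p`,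
`Hironaka1970_thm1_cor p`, `Mizutani1973_vectorGroup_of_dim_le p` hold for every prime `p` and every `e` — pointers to
the tree theorems (`mizutaniLowerBound`, `mizutaniConjecture`, `mizutaniAttained`, `mizutani1973_m_one`,
`Hironaka1970_thm1_cor_holds`, `mizutani1973_vectorGroup_of_dim_le_holds`). -/
theorem closed_statements_hold (p : ℕ) [Fact p.Prime] (e : ℕ) :
    MizutaniLowerBound.{u} p e ∧ MizutaniConjecture.{u} p e ∧ MizutaniAttained.{u} p e ∧
      Mizutani1973_m_one.{u} p ∧ Hironaka1970_thm1_cor.{u} p ∧ Mizutani1973_vectorGroup_of_dim_le.{u} p :=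
  ⟨mizutaniLowerBound p e, mizutaniConjecture p e, mizutaniAttained p e, mizutani1973_m_one p,
    Hironaka1970_thm1_cor_holds p, mizutani1973_vectorGroup_of_dim_le_holds p⟩

end Closed

end Summit.ResolutionOfSingularities.KangarooAtlas.Runbook

end
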